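import Mathlib
import Summits.ValiantsHypothesis.ValiantsHypothesis.Theorems.SymmetroidPencilBasics
import Summits.ValiantsHypothesis.ValiantsHypothesis.Theorems.LacunarySymmetroidMatrixDescartesCensusCrossProductPencil

/-!
# `MatrixDescartes` census — DOOR A tool: SIGNS of the cross-product determinant along a `2 × 2` real symmetric lacunary pencil
# (negative at typed roots, non-positive at definite points), the REVIVAL LEMMA IN TYPE LANGUAGE and the REVIVAL COUNT (all `K`, all supports)

HONEST FRAMING.  Object-search cell `pub-symmetroid`, door-A seat `val-sym-door-p4` (gen 17); items stmt-ValiantsHypothesis-19979 `DoorA26` /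
19980 `DoorA34` (OPEN, typed, never asserted); helper `--supports 19979`, NO closure claim, no definition.  Companion of
`…CensusCrossProductPencil` (X(S,T) := S·J·T − T·J·S, J = !![0,1;-1,0]; ⟪S,T⟫ := (det(S+T) − det S − det T)/2; cross-product pencil
`F̃ = θF·J·F − F·J·θF`, `det F̃ = 4·Gram(θF, F)`; revival lemma with gauge-availability hypotheses).  Nothing here bounds `ζ_sym(2,6)`, decides a
door, or bears on `MatrixDescartes` / `VP ≠ VNP`.

CONTENT.  §6 `exists_kappa_of_singular` (a singular symmetric `2 × 2` matrix with kernel vector `u` is `κ•(u⊥)(u⊥)ᵀ`, `κ = tr/|u|²`, `κ ≠ 0` unless the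
matrix vanishes) · `pairing_singular` (`⟪E₀,F₀⟫ = κ·uᵀE₀u/2`) · `crossDet_neg_of_definiteType` (at a root of DEFINITE TYPE — `F₀` singular non-zero,
kernel `u`, `uᵀE₀u ≠ 0` — `det X(E₀,F₀) = −κ²(uᵀE₀u)² < 0`) · `gram_nonpos_of_definite` (REVERSE CAUCHY–SCHWARZ in `(Sym₂, det)`: `B` definite ⇒
`det A·det B ≤ ⟪A,B⟫²`, via the member of the line `A + s•B` with vanishing `(0,0)` entry) · `crossDet_nonpos_of_definite` (at a DEFINITE point of
the pencil `det F̃ ≤ 0`).  §7 `exists_crossDet_nonneg_Ioo_of_types`: consecutive-type REVIVAL in the inertia kit's currency — `r₁ < r₂`, `det F ≤ 0` on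
`[r₁,r₂]`, `F(rᵢ)` singular non-zero with kernel `uᵢ`, `r₁` of negative and `r₂` of positive type ⇒ some `x ∈ (r₁, r₂)` (OPEN gap) has `det F̃(x) ≥ 0`.
§8 `crossPencil_prod_eq`, `eval_det_crossPencilPoly` (the cross-product pencil as a census-format polynomial pencil indexed by ordered pairs,
`∑_{(l,k)} X^{dₗ+dₖ} • ((dₖ − dₗ)·SₗJSₖ)`, and its determinant's evaluation) and ★ `revivalGaps_le_card_posRoots_crossPencil` — THE REVIVAL COUNT:
`n` revival gaps `0 < a₀ < b₀ ≤ a₁ < b₁ ≤ …` (each with `det F ≤ 0`, singular non-zero typed ends − / +) force at least `n` DISTINCT POSITIVE det-roots of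
the cross-product pencil (one strictly inside each gap; IVT between the negative value at `aⱼ` and the non-negative revival point).  So along a pencil:
`det F̃ < 0` at every root of definite type, `≤ 0` on definite gaps, `≥ 0` somewhere strictly inside every indefinite gap with opposite-type ends, and
every «revival» of the index formula `#roots = |Δν| + 2·min(N⁻,N⁺)` (mdr-p2 kit) is paid for by a positive root of `det F̃`, a `(2, K²)`-indexed lacunary
pencil determinant on the pair sums (memo DOOR-A26-P4G17 §2.4–2.5).  What is NOT typed: the walk bookkeeping «a one-branch twenty at `(2,6)` has 10 such
gaps».  [folklore]; Mathlib + `SymmetroidPencilBasics` + the companion module; axioms standard; no `sorry`, no definitions.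
-/

-- the D-0017 layout repeats a namespace component (single-conjunct summit); the `dupNamespace` linter flags it; name mandated.
set_option linter.dupNamespace false

namespace Summit.ValiantsHypothesis.ValiantsHypothesis.Theorems.LacunarySymmetroidMatrixDescartes.Census.CrossPencil

open Matrix Finset
open scoped BigOperators

/-! ## §6 Signs of the cross-product determinant at definite points and at typed roots -/

/-- **Rank-one normal form of a singular symmetric `2 × 2` matrix along its kernel**: `F₀u = 0`, `u ≠ 0` ⇒
`F₀ = κ • (u⊥)(u⊥)ᵀ` entrywise with `κ = tr F₀ / |u|²`, and `κ ≠ 0` when `F₀ ≠ 0`. [folklore] -/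
theorem exists_kappa_of_singular (F₀ : Matrix (Fin 2) (Fin 2) ℝ) (hF : F₀ 1 0 = F₀ 0 1) (u : Fin 2 → ℝ) (hu : u ≠ 0)
    (hker : F₀ *ᵥ u = 0) :
    ∃ κ : ℝ, F₀ 0 0 = κ * u 1 ^ 2 ∧ F₀ 0 1 = -(κ * (u 0 * u 1)) ∧ F₀ 1 1 = κ * u 0 ^ 2 ∧ (F₀ ≠ 0 → κ ≠ 0) := by
  have h1 : F₀ 0 0 * u 0 + F₀ 0 1 * u 1 = 0 := by
    have := congrFun hker 0; simpa [Matrix.mulVec, dotProduct, Fin.sum_univ_two] using this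
  have h2 : F₀ 0 1 * u 0 + F₀ 1 1 * u 1 = 0 := by
    have := congrFun hker 1; simpa [Matrix.mulVec, dotProduct, Fin.sum_univ_two, hF] using this
  have hn2pos : 0 < u 0 ^ 2 + u 1 ^ 2 := by
    rcases Function.ne_iff.1 hu with ⟨i, hi⟩
    fin_cases i
    · have h0 : 0 < u 0 ^ 2 := lt_of_le_of_ne (sq_nonneg _) (Ne.symm (pow_ne_zero 2 hi))
      linarith [sq_nonneg (u 1)]
    · have h0 : 0 < u 1 ^ 2 := lt_of_le_of_ne (sq_nonneg _) (Ne.symm (pow_ne_zero 2 hi))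
      linarith [sq_nonneg (u 0)]
  refine ⟨(F₀ 0 0 + F₀ 1 1) / (u 0 ^ 2 + u 1 ^ 2), ?_, ?_, ?_, ?_⟩
  · have h : F₀ 0 0 * (u 0 ^ 2 + u 1 ^ 2) = (F₀ 0 0 + F₀ 1 1) * u 1 ^ 2 := by
      linear_combination (u 0) * h1 - (u 1) * h2
    rw [div_mul_eq_mul_div, eq_div_iff hn2pos.ne', h]
  · have h : F₀ 0 1 * (u 0 ^ 2 + u 1 ^ 2) = -((F₀ 0 0 + F₀ 1 1) * (u 0 * u 1)) := by
      linear_combination (u 1) * h1 + (u 0) * h2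
    rw [div_mul_eq_mul_div, ← neg_div, eq_div_iff hn2pos.ne', h]
  · have h : F₀ 1 1 * (u 0 ^ 2 + u 1 ^ 2) = (F₀ 0 0 + F₀ 1 1) * u 0 ^ 2 := by
      linear_combination (-(u 0)) * h1 + (u 1) * h2
    rw [div_mul_eq_mul_div, eq_div_iff hn2pos.ne', h]
  · intro hF0 h0
    have htr : F₀ 0 0 + F₀ 1 1 = 0 := by
      rcases div_eq_zero_iff.1 h0 with h | h
      · exact h
      · exact absurd h hn2pos.ne'
    have ha' : F₀ 0 0 * (u 0 ^ 2 + u 1 ^ 2) = 0 := by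
      linear_combination (u 0) * h1 - (u 1) * h2 + (u 1 ^ 2) * htr
    have ha : F₀ 0 0 = 0 := (mul_eq_zero.1 ha').resolve_right hn2pos.ne'
    have hc : F₀ 1 1 = 0 := by linarith
    have hb : F₀ 0 1 = 0 := by
      have h : F₀ 0 1 * (u 0 ^ 2 + u 1 ^ 2) = -((F₀ 0 0 + F₀ 1 1) * (u 0 * u 1)) := by
        linear_combination (u 1) * h1 + (u 0) * h2
      rw [htr, zero_mul, neg_zero] at h
      exact (mul_eq_zero.1 h).resolve_right hn2pos.ne'
    apply hF0
    ext i j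
    fin_cases i <;> fin_cases j <;> simp [ha, hb, hc, hF]

/-- **Pairing with a singular letter reads the type**: `F₀u = 0` ⇒ `⟪E₀,F₀⟫ = κ·uᵀE₀u / 2` with the `κ` of `exists_kappa_of_singular`. [folklore] -/
theorem pairing_singular (E₀ F₀ : Matrix (Fin 2) (Fin 2) ℝ) (hE : E₀ 1 0 = E₀ 0 1) (hF : F₀ 1 0 = F₀ 0 1) (u : Fin 2 → ℝ)
    (κ : ℝ) (ha : F₀ 0 0 = κ * u 1 ^ 2) (hb : F₀ 0 1 = -(κ * (u 0 * u 1))) (hc : F₀ 1 1 = κ * u 0 ^ 2) :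
    ((E₀ + F₀).det - E₀.det - F₀.det) / 2 = κ * (u ⬝ᵥ (E₀ *ᵥ u)) / 2 := by
  have hF10 : F₀ 1 0 = -(κ * (u 0 * u 1)) := by rw [hF, hb]
  have hτ : u ⬝ᵥ (E₀ *ᵥ u) = E₀ 0 0 * u 0 ^ 2 + 2 * E₀ 0 1 * (u 0 * u 1) + E₀ 1 1 * u 1 ^ 2 := by
    simp [Matrix.mulVec, dotProduct, Fin.sum_univ_two, hE]; ring
  rw [hτ, Matrix.det_fin_two, Matrix.det_fin_two, Matrix.det_fin_two]
  simp only [Matrix.add_apply, hE, hF10, ha, hb, hc]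
  ring

/-- **At a root of DEFINITE TYPE the cross-product determinant is NEGATIVE**: `F₀` symmetric singular non-zero with kernel `u`, `E₀` symmetric
with `uᵀE₀u ≠ 0` ⇒ `det(E₀·J·F₀ − F₀·J·E₀) < 0` (`= −κ²(uᵀE₀u)²`). [folklore] -/
theorem crossDet_neg_of_definiteType (E₀ F₀ : Matrix (Fin 2) (Fin 2) ℝ) (hE : E₀ 1 0 = E₀ 0 1) (hF : F₀ 1 0 = F₀ 0 1)
    (hF0 : F₀ ≠ 0) (hdet : F₀.det = 0) (u : Fin 2 → ℝ) (hu : u ≠ 0) (hker : F₀ *ᵥ u = 0)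
    (htype : u ⬝ᵥ (E₀ *ᵥ u) ≠ 0) :
    (E₀ * !![0, 1; -1, 0] * F₀ - F₀ * !![0, 1; -1, 0] * E₀).det < 0 := by
  obtain ⟨κ, ha, hb, hc, hκ⟩ := exists_kappa_of_singular F₀ hF u hu hker
  have hκ0 := hκ hF0
  have hEs : E₀.IsSymm := by ext i j; fin_cases i <;> fin_cases j <;> simp [hE]
  have hFs : F₀.IsSymm := by ext i j; fin_cases i <;> fin_cases j <;> simp [hF]
  rw [det_cross E₀ F₀ hEs hFs, pairing_singular E₀ F₀ hE hF u κ ha hb hc, hdet, mul_zero, zero_sub]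
  have h1 : 0 < (κ * (u ⬝ᵥ (E₀ *ᵥ u))) ^ 2 := by positivity
  nlinarith

/-- **Reverse Cauchy–Schwarz in `(Sym₂, det)`**: for symmetric `A` and DEFINITE `B` (`B₀₀ ≠ 0`, `det B > 0`) the Gram determinant is
non-positive, `det A·det B ≤ ⟪A,B⟫²` — the line `A + s•B` passes through a matrix with vanishing `(0,0)` entry, whose determinant is `≤ 0`.
[folklore] -/
theorem gram_nonpos_of_definite (A B : Matrix (Fin 2) (Fin 2) ℝ) (hA : A 1 0 = A 0 1) (hB : B 1 0 = B 0 1) (hB00 : B 0 0 ≠ 0)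
    (hBdet : 0 < B.det) : A.det * B.det - (((A + B).det - A.det - B.det) / 2) ^ 2 ≤ 0 := by
  set s₀ : ℝ := -(A 0 0) / B 0 0 with hs₀
  have hq : (A + s₀ • B).det ≤ 0 := by
    have h00 : (A + s₀ • B) 0 0 = 0 := by
      simp only [Matrix.add_apply, Matrix.smul_apply, smul_eq_mul, hs₀]
      field_simp
      ring
    rw [Matrix.det_fin_two, h00, zero_mul, zero_sub]
    have hsym : (A + s₀ • B) 1 0 = (A + s₀ • B) 0 1 := by
      simp only [Matrix.add_apply, Matrix.smul_apply, smul_eq_mul, hA, hB]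
    rw [hsym]
    nlinarith [sq_nonneg ((A + s₀ • B) 0 1)]
  rw [det_add_smul_two] at hq
  set p := (A + B).det - A.det - B.det with hp
  -- `det B · q(s₀) = (det B·s₀ + p/2)² − (p²/4 − det A·det B)` and `det B · q(s₀) ≤ 0`
  nlinarith [sq_nonneg (B.det * s₀ + p / 2), mul_nonpos_of_nonneg_of_nonpos hBdet.le hq]

/-- **At a DEFINITE point the cross-product determinant is `≤ 0`**: `F₀` symmetric definite (`F₀ 0 0 ≠ 0`, `det F₀ > 0`), `E₀` symmetric ⇒
`det(E₀·J·F₀ − F₀·J·E₀) ≤ 0`. [folklore] -/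
theorem crossDet_nonpos_of_definite (E₀ F₀ : Matrix (Fin 2) (Fin 2) ℝ) (hE : E₀ 1 0 = E₀ 0 1) (hF : F₀ 1 0 = F₀ 0 1)
    (hF00 : F₀ 0 0 ≠ 0) (hdet : 0 < F₀.det) :
    (E₀ * !![0, 1; -1, 0] * F₀ - F₀ * !![0, 1; -1, 0] * E₀).det ≤ 0 := by
  have hEs : E₀.IsSymm := by ext i j; fin_cases i <;> fin_cases j <;> simp [hE]
  have hFs : F₀.IsSymm := by ext i j; fin_cases i <;> fin_cases j <;> simp [hF]
  rw [det_cross E₀ F₀ hEs hFs]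
  have h := gram_nonpos_of_definite E₀ F₀ hE hF hF00 hdet
  linarith

/-! ## §7 The revival lemma in TYPE language -/

/-- **REVIVAL BETWEEN TYPED ROOTS.**  `F(x) = ∑ₗ x^{dₗ}Sₗ` real symmetric `2 × 2`, `r₁ < r₂`, `det F ≤ 0` on `[r₁, r₂]`, `F(rᵢ)` singular and non-zero
with kernel vectors `uᵢ`, the root `r₁` of NEGATIVE type (`u₁ᵀ(θF)(r₁)u₁ < 0`) and `r₂` of POSITIVE type.  Then STRICTLY between them the cross-product
pencil `θF·J·F − F·J·θF` has a point of non-negative determinant (at `r₁, r₂` themselves it is negative, `crossDet_neg_of_definiteType`). [folklore] -/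
theorem exists_crossDet_nonneg_Ioo_of_types {K : ℕ} (d : Fin K → ℕ) (S : Fin K → Matrix (Fin 2) (Fin 2) ℝ)
    (hS : ∀ l, (S l).IsSymm) {r₁ r₂ : ℝ} (hr : r₁ < r₂)
    (hgap : ∀ x, r₁ ≤ x → x ≤ r₂ → (∑ l, x ^ (d l) • S l).det ≤ 0)
    (u₁ u₂ : Fin 2 → ℝ) (hu₁ : u₁ ≠ 0) (hu₂ : u₂ ≠ 0)
    (hF₁ : (∑ l, r₁ ^ (d l) • S l) ≠ 0) (hF₂ : (∑ l, r₂ ^ (d l) • S l) ≠ 0)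
    (hker₁ : (∑ l, r₁ ^ (d l) • S l) *ᵥ u₁ = 0) (hker₂ : (∑ l, r₂ ^ (d l) • S l) *ᵥ u₂ = 0)
    (htype₁ : u₁ ⬝ᵥ ((∑ k, ((d k : ℝ) * r₁ ^ (d k)) • S k) *ᵥ u₁) < 0)
    (htype₂ : 0 < u₂ ⬝ᵥ ((∑ k, ((d k : ℝ) * r₂ ^ (d k)) • S k) *ᵥ u₂)) :
    ∃ x, r₁ < x ∧ x < r₂ ∧
      0 ≤ ((∑ k, ((d k : ℝ) * x ^ (d k)) • S k) * !![0, 1; -1, 0] * (∑ l, x ^ (d l) • S l)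
            - (∑ l, x ^ (d l) • S l) * !![0, 1; -1, 0] * (∑ k, ((d k : ℝ) * x ^ (d k)) • S k)).det := by
  have hFs : ∀ x : ℝ, (∑ l, x ^ (d l) • S l) 1 0 = (∑ l, x ^ (d l) • S l) 0 1 := fun x => (isSymm_sum_smul _ S hS).apply 0 1
  have hEs : ∀ x : ℝ, (∑ k, ((d k : ℝ) * x ^ (d k)) • S k) 1 0 = (∑ k, ((d k : ℝ) * x ^ (d k)) • S k) 0 1 :=
    fun x => (isSymm_sum_smul _ S hS).apply 0 1
  have hneg := exists_negGauge_of_negType _ _ (hEs r₁) (hFs r₁) hF₁ u₁ hu₁ hker₁ htype₁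
  have hpos := exists_posGauge_of_posType _ _ (hEs r₂) (hFs r₂) hF₂ u₂ hu₂ hker₂ htype₂
  obtain ⟨x, hx1, hx2, hx⟩ := exists_crossDet_nonneg_of_revival d S hS hr.le hgap hneg hpos
  have hdet₁ : (∑ l, r₁ ^ (d l) • S l).det = 0 := Matrix.exists_mulVec_eq_zero_iff.1 ⟨u₁, hu₁, hker₁⟩
  have hdet₂ : (∑ l, r₂ ^ (d l) • S l).det = 0 := Matrix.exists_mulVec_eq_zero_iff.1 ⟨u₂, hu₂, hker₂⟩
  have hn₁ := crossDet_neg_of_definiteType _ _ (hEs r₁) (hFs r₁) hF₁ hdet₁ u₁ hu₁ hker₁ htype₁.ne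
  have hn₂ := crossDet_neg_of_definiteType _ _ (hEs r₂) (hFs r₂) hF₂ hdet₂ u₂ hu₂ hker₂ htype₂.ne'
  have hx1' : r₁ ≠ x := by
    rintro rfl
    exact absurd hx (not_le.2 hn₁)
  have hx2' : x ≠ r₂ := by
    rintro rfl
    exact absurd hx (not_le.2 hn₂)
  exact ⟨x, lt_of_le_of_ne hx1 hx1', lt_of_le_of_ne hx2 hx2', hx⟩

/-! ## §8 Counting: one root of the cross-product pencil per revival gap -/

/-- The real cross-product pencil indexed by ordered pairs equals `θF·J·F − F·J·θF` up to sign: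
`∑_{(l,k)} x^{dₗ+dₖ} • ((dₖ − dₗ) • SₗJSₖ) = F·J·θF − θF·J·F`. [folklore] -/
theorem crossPencil_prod_eq {K : ℕ} (d : Fin K → ℕ) (S : Fin K → Matrix (Fin 2) (Fin 2) ℝ) (x : ℝ) :
    (∑ p : Fin K × Fin K, x ^ (d p.1 + d p.2) • ((((d p.2 : ℝ) - d p.1)) • (S p.1 * !![0, 1; -1, 0] * S p.2)))
      = (∑ l, x ^ (d l) • S l) * !![0, 1; -1, 0] * (∑ k, ((d k : ℝ) * x ^ (d k)) • S k)
        - (∑ k, ((d k : ℝ) * x ^ (d k)) • S k) * !![0, 1; -1, 0] * (∑ l, x ^ (d l) • S l) := by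
  rw [crossPencil_eq, Fintype.sum_prod_type]
  refine Finset.sum_congr rfl fun l _ => Finset.sum_congr rfl fun k _ => ?_
  rw [smul_smul, mul_comm]

/-- Evaluating the determinant of the polynomial cross-product pencil. [folklore] -/
theorem eval_det_crossPencilPoly {K : ℕ} (d : Fin K → ℕ) (S : Fin K → Matrix (Fin 2) (Fin 2) ℝ) (x : ℝ) :
    ((∑ p : Fin K × Fin K, (Polynomial.X : Polynomial ℝ) ^ (d p.1 + d p.2) •
        ((((d p.2 : ℝ) - d p.1)) • (S p.1 * !![0, 1; -1, 0] * S p.2)).map Polynomial.C).det).eval x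
      = ((∑ k, ((d k : ℝ) * x ^ (d k)) • S k) * !![0, 1; -1, 0] * (∑ l, x ^ (d l) • S l)
          - (∑ l, x ^ (d l) • S l) * !![0, 1; -1, 0] * (∑ k, ((d k : ℝ) * x ^ (d k)) • S k)).det := by
  rw [SymmetroidDescartes.eval_det_pencil (fun p : Fin K × Fin K => (((d p.2 : ℝ) - d p.1)) • (S p.1 * !![0, 1; -1, 0] * S p.2))
    (fun p => d p.1 + d p.2) x]
  rw [crossPencil_prod_eq d S x, ← neg_sub, Matrix.det_neg]
  simp

/-- **REVIVAL COUNT (all `K`, all supports).**  Let `F(x) = ∑ₗ x^{dₗ}Sₗ` be a real symmetric `2 × 2` lacunary pencil and let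
`0 < a₀ < b₀ ≤ a₁ < b₁ ≤ … ≤ a_{n−1} < b_{n−1}` be `n` REVIVAL GAPS: `det F ≤ 0` on `[aⱼ, bⱼ]`, `F` singular and non-zero at both ends with kernel
vectors `uⱼ, vⱼ`, the left end of NEGATIVE and the right end of POSITIVE type.  Then the cross-product pencil
`∑_{(l,k)} X^{dₗ+dₖ} • ((dₖ − dₗ)·SₗJSₖ)` — a real `(2, K²)`-indexed lacunary pencil on the pair sums — has at least `n` distinct positive
det-roots (one strictly inside each gap). [folklore] -/
theorem revivalGaps_le_card_posRoots_crossPencil {K : ℕ} (d : Fin K → ℕ) (S : Fin K → Matrix (Fin 2) (Fin 2) ℝ)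
    (hS : ∀ l, (S l).IsSymm) (n : ℕ) (a b : Fin n → ℝ) (hpos : ∀ j, 0 < a j) (hab : ∀ j, a j < b j)
    (hchain : ∀ i j : Fin n, i < j → b i ≤ a j)
    (hgap : ∀ j x, a j ≤ x → x ≤ b j → (∑ l, x ^ (d l) • S l).det ≤ 0)
    (u v : Fin n → (Fin 2 → ℝ)) (hu : ∀ j, u j ≠ 0) (hv : ∀ j, v j ≠ 0)
    (hFa : ∀ j, (∑ l, (a j) ^ (d l) • S l) ≠ 0) (hFb : ∀ j, (∑ l, (b j) ^ (d l) • S l) ≠ 0)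
    (hkera : ∀ j, (∑ l, (a j) ^ (d l) • S l) *ᵥ u j = 0) (hkerb : ∀ j, (∑ l, (b j) ^ (d l) • S l) *ᵥ v j = 0)
    (htypea : ∀ j, u j ⬝ᵥ ((∑ k, ((d k : ℝ) * (a j) ^ (d k)) • S k) *ᵥ u j) < 0)
    (htypeb : ∀ j, 0 < v j ⬝ᵥ ((∑ k, ((d k : ℝ) * (b j) ^ (d k)) • S k) *ᵥ v j)) :
    n ≤ (((∑ p : Fin K × Fin K, (Polynomial.X : Polynomial ℝ) ^ (d p.1 + d p.2) •
        ((((d p.2 : ℝ) - d p.1)) • (S p.1 * !![0, 1; -1, 0] * S p.2)).map Polynomial.C).det).roots.toFinset.filter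
          (fun t => 0 < t)).card := by
  set P := (∑ p : Fin K × Fin K, (Polynomial.X : Polynomial ℝ) ^ (d p.1 + d p.2) •
        ((((d p.2 : ℝ) - d p.1)) • (S p.1 * !![0, 1; -1, 0] * S p.2)).map Polynomial.C).det with hP
  -- the real cross determinant as a function
  have hev : ∀ x : ℝ, P.eval x = ((∑ k, ((d k : ℝ) * x ^ (d k)) • S k) * !![0, 1; -1, 0] * (∑ l, x ^ (d l) • S l)
          - (∑ l, x ^ (d l) • S l) * !![0, 1; -1, 0] * (∑ k, ((d k : ℝ) * x ^ (d k)) • S k)).det :=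
    fun x => eval_det_crossPencilPoly d S x
  have hFs : ∀ x : ℝ, (∑ l, x ^ (d l) • S l) 1 0 = (∑ l, x ^ (d l) • S l) 0 1 := fun x => (isSymm_sum_smul _ S hS).apply 0 1
  have hEs : ∀ x : ℝ, (∑ k, ((d k : ℝ) * x ^ (d k)) • S k) 1 0 = (∑ k, ((d k : ℝ) * x ^ (d k)) • S k) 0 1 :=
    fun x => (isSymm_sum_smul _ S hS).apply 0 1
  -- one root per gap
  have hroot : ∀ j : Fin n, ∃ ρ, a j < ρ ∧ ρ < b j ∧ P.IsRoot ρ := by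
    intro j
    obtain ⟨x, hx1, hx2, hx⟩ := exists_crossDet_nonneg_Ioo_of_types d S hS (hab j) (hgap j) (u j) (v j) (hu j) (hv j)
      (hFa j) (hFb j) (hkera j) (hkerb j) (htypea j) (htypeb j)
    have hdeta : (∑ l, (a j) ^ (d l) • S l).det = 0 := Matrix.exists_mulVec_eq_zero_iff.1 ⟨u j, hu j, hkera j⟩
    have hneg : P.eval (a j) < 0 := by
      rw [hev]
      exact crossDet_neg_of_definiteType _ _ (hEs (a j)) (hFs (a j)) (hFa j) hdeta (u j) (hu j) (hkera j) (htypea j).ne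
    have hxe : 0 ≤ P.eval x := by rw [hev]; exact hx
    have hcont : ContinuousOn (fun t => P.eval t) (Set.Icc (a j) x) := P.continuous.continuousOn
    obtain ⟨ρ, ⟨hρ1, hρ2⟩, hρ⟩ := intermediate_value_Icc hx1.le hcont ⟨hneg.le, hxe⟩
    have hρa : a j ≠ ρ := by
      rintro h; rw [← h] at hρ; exact hneg.ne hρ
    exact ⟨ρ, lt_of_le_of_ne hρ1 hρa, lt_of_le_of_lt hρ2 hx2, hρ⟩
  choose ρ hρ₁ hρ₂ hρ₃ using hroot
  have hmono : StrictMono ρ := by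
    intro i j hij
    calc ρ i < b i := hρ₂ i
      _ ≤ a j := hchain i j hij
      _ < ρ j := hρ₁ j
  have hPne : ∀ j : Fin n, P ≠ 0 := by
    intro j hP0
    have hdeta : (∑ l, (a j) ^ (d l) • S l).det = 0 := Matrix.exists_mulVec_eq_zero_iff.1 ⟨u j, hu j, hkera j⟩
    have hneg : P.eval (a j) < 0 := by
      rw [hev]
      exact crossDet_neg_of_definiteType _ _ (hEs (a j)) (hFs (a j)) (hFa j) hdeta (u j) (hu j) (hkera j) (htypea j).ne
    rw [hP0, Polynomial.eval_zero] at hneg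
    exact lt_irrefl 0 hneg
  calc n = (Finset.univ : Finset (Fin n)).card := by simp
    _ ≤ (P.roots.toFinset.filter (fun t => 0 < t)).card := by
      refine Finset.card_le_card_of_injOn ρ (fun j _ => ?_) hmono.injective.injOn
      simp only [Finset.mem_coe, Finset.mem_filter, Multiset.mem_toFinset, Polynomial.mem_roots (hPne j)]
      exact ⟨hρ₃ j, (hpos j).trans (hρ₁ j)⟩

end Summit.ValiantsHypothesis.ValiantsHypothesis.Theorems.LacunarySymmetroidMatrixDescartes.Census.CrossPencil
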